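import Literature.NumberTheory.Automorphic.UnitaryCayleyChartDatum        -- ★ p840200 (A-p16 g26): the REGULAR twin (shapes, `exists_isCompact_isOpen_nhds_skewBall`)
import Literature.NumberTheory.Automorphic.SemisimpleOrbitChartUnitary       -- ★ p840712 (B′): the matrix-valued slice chart at a semisimple point + `IsImage {θ-skew} {unitary}`
import HarnessLib

/-!
# The SLICE DATUM of a unitary group `U(σ, J)` at a SEMISIMPLE point, I: the `U`-valued Cayley slice chart `(X, Y) ↦ c(X)·γ c(Y)·c(X)⁻¹` on
# `𝔪_θ × (𝔤_γ)_θ`, and the generic box clause (SAT)∕(SEP′) from Weyl separation at `γ` (N6nsGerm (S1)∕(S2), brick (D1), part a)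

Topic `NumberTheory/Automorphic`; namespace `Literature.NumberTheory.Automorphic`. KERNEL mathematics only: theorems, no definition, no named fact, no
instance, no notation, no `sorry`.  Cell `pub/hodgecm-mathlib` (LEAD F0P3a-plan (g9) WORD T8-38 (1), road «N6nsGerm» of A-p12 (g18), census
`CENSUS-N6nsGerm-S1.A-p16g26.md` brick (D1)).  This is ★ p840200 `UnitaryCayleyChartDatum` §1–§2 RE-RUN AT A SEMISIMPLE (possibly SINGULAR) `γ`:
the torus `Z_U(γ)` of the regular case becomes the centraliser GROUP `T = Z_U(γ)` (closed, non-abelian), the chart's second factor `𝔠 = ker ad γ` is the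
centraliser ALGEBRA `𝔤_γ`, and Weyl separation («a conjugator of two nearby points of the slice lies in `T`») is an INPUT `hW` (supplied at `γ = a·1 ⊕ u·1` by ★
`BlockCentralizerNearScalar.eventually_commute_of_mul_eq_of_frame`) instead of a consequence of regularity.  Harish-Chandra's descent of orbital integrals to
`Z_U(γ)` (Rogawski 1990 Prop. 8.2.1; Langlands–Shelstad 1990 Thm. 2.3.A) integrates over exactly these boxes.

* §1 GENERIC (`U ≤ GL_n(E)` any subgroup, `E` a `T₁` topological field) **`exists_box_of_sliceDatum`**: from an abstract datum `e(a, b) = s(a) τ(b) s(a)⁻¹` and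
  `hW : ∀ᶠ (b, b′) near (b₀, b₀), ∀ y, y τ(b) = τ(b′) y → y ∈ T`, every neighbourhood of `(a₀, b₀)` contains a compact-open box `K × B₁ ⊆ e.source` with
  (SAT) `x τ(b) x⁻¹ ∈ e(K × B₁) ⇒ x ∈ s(K)·T` and (SEP′) `y τ(b) y⁻¹ = τ(b′)`, `b, b′ ∈ B₁` ⇒ `y ∈ T`.
* §2 **`exists_openPartialHomeomorph_unitary_sliceChart`** — ★ p840200 §2 VERBATIM over ★ (B′): TOTAL continuous `s`, `τ` on the θ-skew unit balls
  `A ⊆ [γ, M]`, `B ⊆ 𝔤_γ`, `s(X) = c(X)`, `τ(Y) = γ c(Y) ∈ Z_U(γ)`, `s a₀ = 1`, `τ b₀ = γ`, and `e : OpenPartialHomeomorph (A × B) U` whose forward map IS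
  `(a, b) ↦ s(a) τ(b) s(a)⁻¹`, `(a₀, b₀) ∈ e.source`.
Part b (`UnitarySliceDatum`): group coordinates on the slice factor (`B ≃` a neighbourhood of `γ` in `Z_U(γ)`) and the assembled head with boxes.

HONEST SCOPE.  Point-set topology of matrix groups only.  HC_CM is proved only modulo the printed citations until rung 0 closes; this file discharges no printed
statement.

## References
* [HarishChandra1970] Harish-Chandra (notes by G. van Dijk), *Harmonic Analysis on Reductive p-adic Groups*, LNM 162 (1970), Part I §3, Part II §5 (descent to the
  centraliser of a semisimple element; the submersion `G × M′ → G`).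
* [Rogawski1990] J. D. Rogawski, *Automorphic Representations of Unitary Groups in Three Variables*, Ann. of Math. Stud. 123 (1990), §8.2 Prop. 8.2.1 pp. 112–116.
* [Weyl1939] H. Weyl, *The Classical Groups* (1939), Ch. II §10 (Cayley parametrisation).
-/

set_option autoImplicit false

noncomputable section

open Set Filter Topology Polynomial
open Literature.Analysis.Calculus Literature.LinearAlgebra.Matrix
open scoped Matrix.Norms.Operator Matrix MatrixGroups Pointwise

namespace Literature.NumberTheory.Automorphic

/-! ## §0 Compact open neighbourhoods in a locally compact Hausdorff totally disconnected space -/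

/-- Every neighbourhood of a point of a locally compact Hausdorff totally disconnected space contains a COMPACT OPEN neighbourhood of the point
(clopen basis, Mathlib `loc_compact_Haus_tot_disc_of_zero_dim`, inside a compact neighbourhood). [folklore] -/
private theorem exists_isCompact_isOpen_mem_subset_of_mem_nhds {X : Type*} [TopologicalSpace X] [LocallyCompactSpace X] [T2Space X]
    [TotallyDisconnectedSpace X] {x : X} {N : Set X} (hN : N ∈ 𝓝 x) :
    ∃ V : Set X, IsCompact V ∧ IsOpen V ∧ x ∈ V ∧ V ⊆ N := by
  obtain ⟨L, hLc, hLx⟩ := WeaklyLocallyCompactSpace.exists_compact_mem_nhds x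
  have hx' : x ∈ interior (L ∩ N) := mem_interior_iff_mem_nhds.2 (inter_mem hLx hN)
  obtain ⟨C, hCclopen, hxC, hCsub⟩ :=
    (loc_compact_Haus_tot_disc_of_zero_dim (H := X)).exists_subset_of_mem_open hx' isOpen_interior
  exact ⟨C, hLc.of_isClosed_subset hCclopen.1 (hCsub.trans (interior_subset.trans inter_subset_left)), hCclopen.2, hxC,
    hCsub.trans (interior_subset.trans inter_subset_right)⟩


/-! ## §1 GENERIC: an abstract SLICE datum on a subgroup `U ≤ GL_n(E)` ⇒ saturated, `T`-separated compact-open boxes -/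

section Subgroup

variable {E : Type*} [Field E] [TopologicalSpace E] [IsTopologicalRing E] [T1Space E]
  {n : Type*} [Fintype n] [DecidableEq n] {U : Subgroup (GL n E)}
  {A B : Type*} [TopologicalSpace A] [TopologicalSpace B]

omit [IsTopologicalRing E] [T1Space E] in
/-- **The box clause for an abstract SLICE datum.** `U ≤ GL_n(E)`, `T ≤ U` (the centraliser of a semisimple `γ`), `e : A × B → U` an open partial homeomorphism
equal to `(a, b) ↦ s(a) τ(b) s(a)⁻¹` on its source, and WEYL SEPARATION at `b₀`: `hW : ∀ᶠ (b, b′) near (b₀, b₀), ∀ y ∈ U, y τ(b) = τ(b′) y → y ∈ T`.  Then every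
neighbourhood of `(a₀, b₀)` contains a compact-open box `K × B₁ ⊆ e.source` on which (SAT) `x τ(b) x⁻¹ ∈ e(K × B₁) ⇒ x ∈ s(K)·T` and (SEP′) a conjugator of
`τ b` into `τ b′` (`b, b′ ∈ B₁`) lies in `T`. [cite: HarishChandra1970, Part I §3; Part II §5] [cite: Rogawski1990, §8.2 Prop. 8.2.1 p. 112] -/
theorem exists_box_of_sliceDatum (T : Subgroup ↥U) (s : A → ↥U) (τ : B → ↥U) (e : OpenPartialHomeomorph (A × B) ↥U)
    (he : ∀ p ∈ e.source, e p = s p.1 * τ p.2 * (s p.1)⁻¹) {a₀ : A} {b₀ : B} (h₀ : (a₀, b₀) ∈ e.source)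
    (hW : ∀ᶠ q : B × B in 𝓝 (b₀, b₀), ∀ y : ↥U, y * τ q.1 = τ q.2 * y → y ∈ T)
    (hA : ∀ N ∈ 𝓝 a₀, ∃ K : Set A, IsCompact K ∧ IsOpen K ∧ a₀ ∈ K ∧ K ⊆ N)
    (hB : ∀ N ∈ 𝓝 b₀, ∃ K : Set B, IsCompact K ∧ IsOpen K ∧ b₀ ∈ K ∧ K ⊆ N) :
    ∀ N ∈ 𝓝 (a₀, b₀), ∃ (K : Set A) (B₁ : Set B), IsCompact K ∧ IsOpen K ∧ a₀ ∈ K ∧ IsCompact B₁ ∧ IsOpen B₁ ∧ b₀ ∈ B₁ ∧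
      K ×ˢ B₁ ⊆ N ∧ K ×ˢ B₁ ⊆ e.source ∧
      (∀ b ∈ B₁, ∀ x : ↥U, x * τ b * x⁻¹ ∈ e '' (K ×ˢ B₁) → x ∈ s '' K * (T : Set ↥U)) ∧
      (∀ b ∈ B₁, ∀ b' ∈ B₁, ∀ y : ↥U, y * τ b * y⁻¹ = τ b' → y ∈ T) := by
  intro N hN
  -- (1) the Weyl-separated box
  obtain ⟨W₃, hW₃, W₄, hW₄, hW₃₄⟩ := mem_nhds_prod_iff.1 hW
  -- (2) the prescribed neighbourhood, cut into a product inside `e.source`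
  have hNs : N ∩ e.source ∈ 𝓝 (a₀, b₀) := inter_mem hN (e.open_source.mem_nhds h₀)
  obtain ⟨NA, hNA, NB, hNB, hNAB⟩ := mem_nhds_prod_iff.1 hNs
  obtain ⟨K, hKc, hKo, haK, hKN⟩ := hA NA hNA
  obtain ⟨B₁, hB₁c, hB₁o, hbB, hB₁N⟩ := hB (NB ∩ (W₃ ∩ W₄)) (inter_mem hNB (inter_mem hW₃ hW₄))
  have hKB : K ×ˢ B₁ ⊆ N ∩ e.source := fun p hp => hNAB (mk_mem_prod (hKN hp.1) (hB₁N hp.2).1)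
  have hsep : ∀ b ∈ B₁, ∀ b' ∈ B₁, ∀ y : ↥U, y * τ b * y⁻¹ = τ b' → y ∈ T := fun b hb b' hb' y hy =>
    hW₃₄ (mk_mem_prod (hB₁N hb).2.1 (hB₁N hb').2.2) y (by rw [← hy, mul_assoc, mul_assoc, inv_mul_cancel, mul_one])
  refine ⟨K, B₁, hKc, hKo, haK, hB₁c, hB₁o, hbB, fun p hp => (hKB hp).1, fun p hp => (hKB hp).2, ?_, hsep⟩
  -- (SAT)
  intro b hb x hx
  obtain ⟨p, hp, hpx⟩ := hx
  obtain ⟨a', b'⟩ := p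
  have hp' : (a', b') ∈ K ×ˢ B₁ := hp
  rw [he _ (hKB hp').2] at hpx
  -- `x τ(b) x⁻¹ = s(a′) τ(b′) s(a′)⁻¹` ⇒ `(s(a′)⁻¹ x)` conjugates `τ b` into `τ b′` ⇒ lies in `T`
  have hpx' : x * τ b * x⁻¹ = s a' * τ b' * (s a')⁻¹ := hpx.symm
  have hy : ((s a')⁻¹ * x) * τ b * ((s a')⁻¹ * x)⁻¹ = τ b' := by
    calc ((s a')⁻¹ * x) * τ b * ((s a')⁻¹ * x)⁻¹ = (s a')⁻¹ * (x * τ b * x⁻¹) * s a' := by group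
      _ = τ b' := by rw [hpx']; group
  have hT : (s a')⁻¹ * x ∈ T := hsep b hb b' hp'.2 _ hy
  refine Set.mem_mul.2 ⟨s a', ⟨a', hp'.1, rfl⟩, (s a')⁻¹ * x, hT, ?_⟩
  rw [← mul_assoc, mul_inv_cancel, one_mul]

end Subgroup

/-! ## §2 The Cayley SLICE chart of `U(σ, J)` at a semisimple `γ` as an `OpenPartialHomeomorph (A × B) U` -/

section Unitary

variable {E : Type*} [NontriviallyNormedField E] [CompleteSpace E] {n : Type*} [Fintype n] [DecidableEq n]

/-- **The Cayley SLICE chart as a `U`-valued open partial homeomorphism.** For `γ ∈ U = U(σ, J)` SEMISIMPLE (annihilated by a separable `p`) there are TOTAL continuous maps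
`s : A → U`, `τ : B → U` on the θ-skew unit balls `A ⊆ [γ, M]`, `B ⊆ C(γ)` with `s(X) = c(X)`, `τ(Y) = γ c(Y) ∈ Z_U(γ)`, base points `a₀ = 0`, `b₀ = 0`
(`s a₀ = 1`, `τ b₀ = γ`), and an `OpenPartialHomeomorph e : A × B → U` with `(a₀, b₀) ∈ e.source` whose forward map IS `(a, b) ↦ s(a) τ(b) s(a)⁻¹`
(A-p16 (g25)'s matrix-valued chart ★ `exists_openPartialHomeomorph_cayleyConj_isImage_unitary` restricted along its `IsImage {θ-skew} {unitary}`).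
[cite: Weyl1939, Ch. II §10] [cite: HarishChandra1970, Part I §3] -/
theorem exists_openPartialHomeomorph_unitary_sliceChart [CharZero E] (σ : E →+* E) (hσ : Continuous σ) {J : Matrix n n E}
    (hJ : IsUnit J.det) (γ : ↥(unitaryGroupOfForm σ J)) {p : Polynomial E} (hp : p.Separable)
    (hγ : Polynomial.aeval ((γ : GL n E) : Matrix n n E) p = 0) :
    ∃ (s : ↥{X : Matrix n n E | X ∈ LinearMap.range (LinearMap.mulLeft E ((γ : GL n E) : Matrix n n E) -
            LinearMap.mulRight E ((γ : GL n E) : Matrix n n E)) ∧ J⁻¹ * (X.map σ)ᵀ * J = -X ∧ ‖X‖ < 1} → ↥(unitaryGroupOfForm σ J))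
      (τ : ↥{Y : Matrix n n E | Y ∈ LinearMap.ker (LinearMap.mulLeft E ((γ : GL n E) : Matrix n n E) -
            LinearMap.mulRight E ((γ : GL n E) : Matrix n n E)) ∧ J⁻¹ * (Y.map σ)ᵀ * J = -Y ∧ ‖Y‖ < 1} → ↥(unitaryGroupOfForm σ J))
      (e : OpenPartialHomeomorph
        (↥{X : Matrix n n E | X ∈ LinearMap.range (LinearMap.mulLeft E ((γ : GL n E) : Matrix n n E) -
            LinearMap.mulRight E ((γ : GL n E) : Matrix n n E)) ∧ J⁻¹ * (X.map σ)ᵀ * J = -X ∧ ‖X‖ < 1} ×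
          ↥{Y : Matrix n n E | Y ∈ LinearMap.ker (LinearMap.mulLeft E ((γ : GL n E) : Matrix n n E) -
            LinearMap.mulRight E ((γ : GL n E) : Matrix n n E)) ∧ J⁻¹ * (Y.map σ)ᵀ * J = -Y ∧ ‖Y‖ < 1})
        ↥(unitaryGroupOfForm σ J))
      (a₀ : ↥{X : Matrix n n E | X ∈ LinearMap.range (LinearMap.mulLeft E ((γ : GL n E) : Matrix n n E) -
            LinearMap.mulRight E ((γ : GL n E) : Matrix n n E)) ∧ J⁻¹ * (X.map σ)ᵀ * J = -X ∧ ‖X‖ < 1})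
      (b₀ : ↥{Y : Matrix n n E | Y ∈ LinearMap.ker (LinearMap.mulLeft E ((γ : GL n E) : Matrix n n E) -
            LinearMap.mulRight E ((γ : GL n E) : Matrix n n E)) ∧ J⁻¹ * (Y.map σ)ᵀ * J = -Y ∧ ‖Y‖ < 1}),
      (∀ a, (((s a : ↥(unitaryGroupOfForm σ J)) : GL n E) : Matrix n n E) = cayley (a : Matrix n n E)) ∧
      (∀ b, (((τ b : ↥(unitaryGroupOfForm σ J)) : GL n E) : Matrix n n E) = ((γ : GL n E) : Matrix n n E) * cayley (b : Matrix n n E)) ∧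
      Continuous s ∧ Continuous τ ∧ (a₀ : Matrix n n E) = 0 ∧ (b₀ : Matrix n n E) = 0 ∧ s a₀ = 1 ∧ τ b₀ = γ ∧
      (∀ b, τ b ∈ Subgroup.centralizer ({γ} : Set ↥(unitaryGroupOfForm σ J))) ∧
      (a₀, b₀) ∈ e.source ∧ ∀ p, e p = s p.1 * τ p.2 * (s p.1)⁻¹ := by
  classical
  haveI : CompleteSpace (Matrix n n E) := FiniteDimensional.complete E (Matrix n n E)
  haveI : HasSummableGeomSeries (Matrix n n E) :=
    @instHasSummableGeomSeriesOfCompleteSpace (Matrix n n E) _ (FiniteDimensional.complete E (Matrix n n E))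
  obtain ⟨e₃, h0, -, he₃, -, hIm⟩ := exists_openPartialHomeomorph_cayleyConj_isImage_unitary_of_separable_aeval_eq_zero σ hσ hJ (γ : GL n E) γ.2 hp hγ
  -- `1 ± X` are units inside the unit ball
  have h1S : ∀ {X : Matrix n n E}, ‖X‖ < 1 → IsUnit (1 + X) := fun {X} h => by
    have hu := (Units.oneSub (-X) (by rwa [norm_neg])).isUnit
    rwa [Units.val_oneSub, sub_neg_eq_add] at hu
  have h2S : ∀ {X : Matrix n n E}, ‖X‖ < 1 → IsUnit (1 - X) := fun {X} h => by
    have hu := (Units.oneSub X h).isUnit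
    rwa [Units.val_oneSub] at hu
  -- the carriers
  set SA : Set (Matrix n n E) := {X | X ∈ LinearMap.range (LinearMap.mulLeft E ((γ : GL n E) : Matrix n n E) -
      LinearMap.mulRight E ((γ : GL n E) : Matrix n n E)) ∧ J⁻¹ * (X.map σ)ᵀ * J = -X ∧ ‖X‖ < 1} with hSA
  set SB : Set (Matrix n n E) := {Y | Y ∈ LinearMap.ker (LinearMap.mulLeft E ((γ : GL n E) : Matrix n n E) -
      LinearMap.mulRight E ((γ : GL n E) : Matrix n n E)) ∧ J⁻¹ * (Y.map σ)ᵀ * J = -Y ∧ ‖Y‖ < 1} with hSB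
  have hSA1 : ∀ X ∈ SA, ‖X‖ < 1 := fun X hX => hX.2.2
  have hSB1 : ∀ Y ∈ SB, ‖Y‖ < 1 := fun Y hY => hY.2.2
  have hcU : ∀ {X : Matrix n n E}, J⁻¹ * (X.map σ)ᵀ * J = -X → (hp : IsUnit (1 + X)) → (hq : IsUnit (1 - X)) →
      (isUnit_cayley hp hq).unit ∈ unitaryGroupOfForm σ J := fun {X} hX hp hq => by
    obtain ⟨g, hg, hgc⟩ := cayley_mem_unitaryGroupOfForm (σ := σ) hJ hX hp hq
    have hge : (isUnit_cayley hp hq).unit = g := Units.ext (by rw [IsUnit.unit_spec, hgc])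
    rw [hge]
    exact hg
  -- the chart datum `s`, `τ`
  let s : ↥SA → ↥(unitaryGroupOfForm σ J) := fun a =>
    ⟨(isUnit_cayley (h1S (hSA1 a a.2)) (h2S (hSA1 a a.2))).unit, hcU a.2.2.1 (h1S (hSA1 a a.2)) (h2S (hSA1 a a.2))⟩
  let cB : ↥SB → ↥(unitaryGroupOfForm σ J) := fun b =>
    ⟨(isUnit_cayley (h1S (hSB1 b b.2)) (h2S (hSB1 b b.2))).unit, hcU b.2.2.1 (h1S (hSB1 b b.2)) (h2S (hSB1 b b.2))⟩
  let τ : ↥SB → ↥(unitaryGroupOfForm σ J) := fun b => γ * cB b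
  have hsval : ∀ a : ↥SA, (((s a : ↥(unitaryGroupOfForm σ J)) : GL n E) : Matrix n n E) = cayley (a : Matrix n n E) := fun a => rfl
  have hτval : ∀ b : ↥SB, (((τ b : ↥(unitaryGroupOfForm σ J)) : GL n E) : Matrix n n E) =
      ((γ : GL n E) : Matrix n n E) * cayley (b : Matrix n n E) := fun b => rfl
  have hs : Continuous s :=
    (continuous_cayleyUnit (S := SA) (fun a => h1S (hSA1 a a.2)) (fun a => h2S (hSA1 a a.2))).subtype_mk _
  have hτ : Continuous τ :=
    continuous_const.mul ((continuous_cayleyUnit (S := SB) (fun b => h1S (hSB1 b b.2)) (fun b => h2S (hSB1 b b.2))).subtype_mk _)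
  -- base points
  have hθ0 : J⁻¹ * ((0 : Matrix n n E).map σ)ᵀ * J = -0 := by
    rw [Matrix.map_zero σ (map_zero σ), Matrix.transpose_zero, Matrix.mul_zero, Matrix.zero_mul, neg_zero]
  let a₀ : ↥SA := ⟨0, LinearMap.mem_range.2 ⟨0, map_zero _⟩, hθ0, by rw [norm_zero]; exact one_pos⟩
  let b₀ : ↥SB := ⟨0, LinearMap.mem_ker.2 (map_zero _), hθ0, by rw [norm_zero]; exact one_pos⟩
  have hs₀ : s a₀ = 1 := by
    apply Subtype.ext
    apply Units.ext
    rw [hsval a₀, show ((a₀ : ↥SA) : Matrix n n E) = 0 from rfl, cayley_zero]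
    rfl
  have hτ₀ : τ b₀ = γ := by
    apply Subtype.ext
    apply Units.ext
    rw [hτval b₀, show ((b₀ : ↥SB) : Matrix n n E) = 0 from rfl, cayley_zero, mul_one]
  have hcomm : ∀ b : ↥SB, τ b ∈ Subgroup.centralizer ({γ} : Set ↥(unitaryGroupOfForm σ J)) := fun b => by
    have hk : Commute ((γ : GL n E) : Matrix n n E) (b : Matrix n n E) := by
      have h := LinearMap.mem_ker.1 b.2.1
      rw [LinearMap.sub_apply, LinearMap.mulLeft_apply, LinearMap.mulRight_apply, sub_eq_zero] at h
      exact h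
    have hc := commute_cayley hk (h1S (hSB1 b b.2))
    rw [Subgroup.mem_centralizer_singleton_iff]
    apply Subtype.ext
    apply Units.ext
    show (((τ b : ↥(unitaryGroupOfForm σ J)) : GL n E) : Matrix n n E) * ((γ : GL n E) : Matrix n n E) =
      ((γ : GL n E) : Matrix n n E) * (((τ b : ↥(unitaryGroupOfForm σ J)) : GL n E) : Matrix n n E)
    rw [hτval, mul_assoc, ← hc.eq]
  -- the inclusion `ι : A × B → 𝔪 × 𝔠` and the forward map `Φ`
  let ι : ↥SA × ↥SB →
      ↥(LinearMap.range (LinearMap.mulLeft E ((γ : GL n E) : Matrix n n E) - LinearMap.mulRight E ((γ : GL n E) : Matrix n n E))) ×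
        ↥(LinearMap.ker (LinearMap.mulLeft E ((γ : GL n E) : Matrix n n E) - LinearMap.mulRight E ((γ : GL n E) : Matrix n n E))) :=
    fun p => (⟨(p.1 : Matrix n n E), p.1.2.1⟩, ⟨(p.2 : Matrix n n E), p.2.2.1⟩)
  have hι : Continuous ι :=
    ((continuous_subtype_val.comp continuous_fst).subtype_mk _).prodMk ((continuous_subtype_val.comp continuous_snd).subtype_mk _)
  let Φ : ↥SA × ↥SB → ↥(unitaryGroupOfForm σ J) := fun p => s p.1 * τ p.2 * (s p.1)⁻¹
  have hΦc : Continuous Φ := ((hs.comp continuous_fst).mul (hτ.comp continuous_snd)).mul ((hs.comp continuous_fst).inv)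
  have hΦval : ∀ p, (((Φ p : ↥(unitaryGroupOfForm σ J)) : GL n E) : Matrix n n E) = e₃ (ι p) := fun p => by
    rw [he₃]
    show (((s p.1 : ↥(unitaryGroupOfForm σ J)) : GL n E) : Matrix n n E) * (((τ p.2 : ↥(unitaryGroupOfForm σ J)) : GL n E) : Matrix n n E) *
        ((((s p.1 : ↥(unitaryGroupOfForm σ J)))⁻¹ : GL n E) : Matrix n n E) =
      cayley (p.1 : Matrix n n E) * (((γ : GL n E) : Matrix n n E) * cayley (p.2 : Matrix n n E)) * Ring.inverse (cayley (p.1 : Matrix n n E))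
    rw [hτval, ← Ring.inverse_unit]
    rfl
  -- the backward projections (total; the identity on the carriers)
  let prA : Matrix n n E → ↥SA := fun X => if h : X ∈ SA then ⟨X, h⟩ else a₀
  let prB : Matrix n n E → ↥SB := fun Y => if h : Y ∈ SB then ⟨Y, h⟩ else b₀
  have hprA : ContinuousOn prA SA := by
    rw [continuousOn_iff_continuous_restrict]
    have h : SA.restrict prA = id := funext fun x => by
      show prA (x : Matrix n n E) = x
      simp only [prA, dif_pos x.2]
    rw [h]
    exact continuous_id
  have hprB : ContinuousOn prB SB := by
    rw [continuousOn_iff_continuous_restrict]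
    have h : SB.restrict prB = id := funext fun x => by
      show prB (x : Matrix n n E) = x
      simp only [prB, dif_pos x.2]
    rw [h]
    exact continuous_id
  -- what the image condition gives on the target side
  have hback : ∀ u : ↥(unitaryGroupOfForm σ J), ((u : GL n E) : Matrix n n E) ∈ e₃.target →
      ‖((e₃.symm ((u : GL n E) : Matrix n n E)).1 : Matrix n n E)‖ < 1 → ‖((e₃.symm ((u : GL n E) : Matrix n n E)).2 : Matrix n n E)‖ < 1 →
      ((e₃.symm ((u : GL n E) : Matrix n n E)).1 : Matrix n n E) ∈ SA ∧ ((e₃.symm ((u : GL n E) : Matrix n n E)).2 : Matrix n n E) ∈ SB := by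
    intro u hu h1 h2
    have hsrc : e₃.symm ((u : GL n E) : Matrix n n E) ∈ e₃.source := e₃.map_target hu
    have hval : e₃ (e₃.symm ((u : GL n E) : Matrix n n E)) = ((u : GL n E) : Matrix n n E) := e₃.right_inv hu
    have hT : e₃ (e₃.symm ((u : GL n E) : Matrix n n E)) ∈ {W : Matrix n n E | ∃ g ∈ unitaryGroupOfForm σ J, (g : Matrix n n E) = W} :=
      ⟨(u : GL n E), u.2, hval.symm⟩
    have hθ := (hIm hsrc).1 hT
    exact ⟨⟨(e₃.symm ((u : GL n E) : Matrix n n E)).1.2, hθ.1, h1⟩, ⟨(e₃.symm ((u : GL n E) : Matrix n n E)).2.2, hθ.2, h2⟩⟩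
  -- the open partial homeomorphism
  have hcoe : Continuous fun u : ↥(unitaryGroupOfForm σ J) => ((u : GL n E) : Matrix n n E) :=
    Units.continuous_val.comp continuous_subtype_val
  refine ⟨s, τ,
    { toFun := Φ
      invFun := fun u => (prA ((e₃.symm ((u : GL n E) : Matrix n n E)).1 : Matrix n n E), prB ((e₃.symm ((u : GL n E) : Matrix n n E)).2 : Matrix n n E))
      source := ι ⁻¹' e₃.source
      target := (fun u : ↥(unitaryGroupOfForm σ J) => ((u : GL n E) : Matrix n n E)) ⁻¹'
        (e₃.target ∩ e₃.symm ⁻¹' {x | ‖(x.1 : Matrix n n E)‖ < 1 ∧ ‖(x.2 : Matrix n n E)‖ < 1})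
      map_source' := ?_
      map_target' := ?_
      left_inv' := ?_
      right_inv' := ?_
      open_source := e₃.open_source.preimage hι
      open_target := (e₃.isOpen_inter_preimage_symm
        ((isOpen_lt (continuous_norm.comp (continuous_subtype_val.comp continuous_fst)) continuous_const).inter
          (isOpen_lt (continuous_norm.comp (continuous_subtype_val.comp continuous_snd)) continuous_const))).preimage hcoe
      continuousOn_toFun := hΦc.continuousOn
      continuousOn_invFun := ?_ }, a₀, b₀, hsval, hτval, hs, hτ, rfl, rfl, hs₀, hτ₀, hcomm, ?_, fun p => rfl⟩
  · -- map_source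
    intro p hp
    have hp' : ι p ∈ e₃.source := hp
    refine ⟨?_, ?_⟩
    · show (((Φ p : ↥(unitaryGroupOfForm σ J)) : GL n E) : Matrix n n E) ∈ e₃.target
      rw [hΦval]
      exact e₃.map_source hp'
    · show e₃.symm (((Φ p : ↥(unitaryGroupOfForm σ J)) : GL n E) : Matrix n n E) ∈ {x :
          ↥(LinearMap.range (LinearMap.mulLeft E ((γ : GL n E) : Matrix n n E) - LinearMap.mulRight E ((γ : GL n E) : Matrix n n E))) ×
          ↥(LinearMap.ker (LinearMap.mulLeft E ((γ : GL n E) : Matrix n n E) - LinearMap.mulRight E ((γ : GL n E) : Matrix n n E))) |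
          ‖(x.1 : Matrix n n E)‖ < 1 ∧ ‖(x.2 : Matrix n n E)‖ < 1}
      rw [hΦval, e₃.left_inv hp']
      exact ⟨p.1.2.2.2, p.2.2.2.2⟩
  · -- map_target
    intro u hu
    obtain ⟨hA, hB⟩ := hback u hu.1 hu.2.1 hu.2.2
    show ι (prA ((e₃.symm ((u : GL n E) : Matrix n n E)).1 : Matrix n n E), prB ((e₃.symm ((u : GL n E) : Matrix n n E)).2 : Matrix n n E)) ∈ e₃.source
    have h1 : ι (prA ((e₃.symm ((u : GL n E) : Matrix n n E)).1 : Matrix n n E), prB ((e₃.symm ((u : GL n E) : Matrix n n E)).2 : Matrix n n E)) =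
        e₃.symm ((u : GL n E) : Matrix n n E) := by
      simp only [ι, prA, prB, dif_pos hA, dif_pos hB]
    rw [h1]
    exact e₃.map_target hu.1
  · -- left_inv
    intro p hp
    have hp' : ι p ∈ e₃.source := hp
    have h1 : e₃.symm (((Φ p : ↥(unitaryGroupOfForm σ J)) : GL n E) : Matrix n n E) = ι p := by rw [hΦval, e₃.left_inv hp']
    show (prA ((e₃.symm (((Φ p : ↥(unitaryGroupOfForm σ J)) : GL n E) : Matrix n n E)).1 : Matrix n n E),
        prB ((e₃.symm (((Φ p : ↥(unitaryGroupOfForm σ J)) : GL n E) : Matrix n n E)).2 : Matrix n n E)) = p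
    rw [h1]
    exact Prod.ext (by simp only [ι, prA, dif_pos p.1.2]) (by simp only [ι, prB, dif_pos p.2.2])
  · -- right_inv
    intro u hu
    obtain ⟨hA, hB⟩ := hback u hu.1 hu.2.1 hu.2.2
    apply Subtype.ext
    apply Units.ext
    show (((Φ (prA ((e₃.symm ((u : GL n E) : Matrix n n E)).1 : Matrix n n E), prB ((e₃.symm ((u : GL n E) : Matrix n n E)).2 : Matrix n n E)) :
        ↥(unitaryGroupOfForm σ J)) : GL n E) : Matrix n n E) = ((u : GL n E) : Matrix n n E)
    rw [hΦval]
    have h1 : ι (prA ((e₃.symm ((u : GL n E) : Matrix n n E)).1 : Matrix n n E), prB ((e₃.symm ((u : GL n E) : Matrix n n E)).2 : Matrix n n E)) =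
        e₃.symm ((u : GL n E) : Matrix n n E) := by
      simp only [ι, prA, prB, dif_pos hA, dif_pos hB]
    rw [h1]
    exact e₃.right_inv hu.1
  · -- continuity of the inverse on the target
    have hsymm : ContinuousOn (fun u : ↥(unitaryGroupOfForm σ J) => e₃.symm ((u : GL n E) : Matrix n n E))
        ((fun u : ↥(unitaryGroupOfForm σ J) => ((u : GL n E) : Matrix n n E)) ⁻¹'
          (e₃.target ∩ e₃.symm ⁻¹' {x | ‖(x.1 : Matrix n n E)‖ < 1 ∧ ‖(x.2 : Matrix n n E)‖ < 1})) :=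
      e₃.continuousOn_symm.comp hcoe.continuousOn fun u hu => hu.1
    refine ContinuousOn.prodMk ?_ ?_
    · exact hprA.comp ((continuous_subtype_val.comp continuous_fst).comp_continuousOn hsymm) fun u hu => (hback u hu.1 hu.2.1 hu.2.2).1
    · exact hprB.comp ((continuous_subtype_val.comp continuous_snd).comp_continuousOn hsymm) fun u hu => (hback u hu.1 hu.2.1 hu.2.2).2
  · -- `(a₀, b₀) ∈ e.source`
    show ι (a₀, b₀) ∈ e₃.source
    have h1 : ι (a₀, b₀) = 0 := Prod.ext (Subtype.ext rfl) (Subtype.ext rfl)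
    rw [h1]
    exact h0

end Unitary

end Literature.NumberTheory.Automorphic
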